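import Summits.BirchSwinnertonDyer.BirchSwinnertonDyer.Theorems.UniversalToricDescentTwinSplitIMCAtThreeOfThreeFrames
import Literature.NumberTheory.EllipticCurves.UnrIntegersUnits
import HarnessLib

/-!
# Route `UniversalToricDescent`, crux #3 `TwinSplitIMCAtThree` (item stmt-BirchSwinnertonDyer-20214; children
# 20694 `…Mult`, 20695 `…GoodSS` of route rev 17) AT ANY TWIN: the VALUE-FRAME route — a Howard frame plus a
# principal characteristic ideal whose generator's constant term has the norm of `L(𝟙)` give clause (ii) at
# EVERY frame ("unit detection", the class-number-formula upgrade of a one-sided divisibility)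

Seat `bsd-wall-utd-p2` g2 (D-0131 (3) MIDDLE tier; memo `HOME/bsd-wall/bsd-wall-utd-p2/SUPSET-AT3-v4.md`).
Companion of `…TwinSplitIMCAtThreeOfThreeFrames.lean` (p543791: Howard frame + rational Wan frame + `μ = 0`
frame). Here the Wan-direction frame is replaced by VALUE data at the trivial character: if
`I = (F)` is principal with `F(0) ≠ 0` and SOME frame `L₂` has `‖L₂(0)‖ = ‖F(0)‖`, then a Howard frame
(`L₁ ∈ I`) already forces `I = (L′)` at every frame — because `L₂ = F·q` with `‖q(0)‖ = 1`, i.e. `q(0) ∈ R₀ˣ`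
(`unrIntegers.isUnit_iff_norm_eq_one`), so `q ∈ R₀⟦T⟧ˣ`. This is the kernel form of the mechanism of the
crux-idea cards `cnf-upgrade-at-twin` (utd-idea g0) and `signfree-cnf-ss-twin` (utd-idea g1): on a twin
`E′/K` of analytic rank one the value data is «anticyclotomic control at `T = 0` (JSW 2017 Thm. 3.3.1 +
(3.5.d), typed at `p = 3` for GOOD reduction, `JetchevSkinnerWan2017.thm331_anticyclotomicControl`) + the BDP
value formula (CGLS 2022 Thm. 5.1.3, `p ∤ N′`) + the `3`-part of BSD for `E′/K`», none of which is
asserted here. Nothing number-theoretic is assumed: pure algebra over `R₀⟦T⟧` plus the tree's integral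
cross-period rigidity (p536114).

* `span_singleton_eq_of_mem_of_norm_constantCoeff_eq` (any prime) — `L ∈ (F)`, `F(0) ≠ 0`,
  `‖L(0)‖ = ‖F(0)‖` ⟹ `(F) = (L)`.
* `eq_span_forall_frame_of_howardFrame_of_valueFrame` (any prime, abstract principal `I = (F)`) — Howard
  frame + value frame ⟹ `I = (L′)` at EVERY frame.
* `twinSplit_instance_of_howardFrame_of_valueFrame` (`p = 3`, crux currency, ANY twin) — conjuncts (i) ∧ (ii)
  of `TwinSplitIMCAtThree` verbatim from a Howard frame and value data for `Ch_Λ(X_ac(W′_K) strict at 𝔭′)·R₀⟦T⟧`.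

PARTITION currency: bucket C (603; child 20695): Howard frame = the PRE claim p545192 by name (p546254); value
data = control (refereed, typed at `3`) + value formula (refereed) + BSD₃ of the twin pair over `K` (the W-ALL
row-C3 / corner-X7 residuals — OPEN); so this route turns child 20695 into NAMED inputs only, none new. Bucket
B (675; child 20694): control at `3 ∥ N′` is typed (`JetchevSkinnerWan2017.AnticyclotomicControlMultiplicative`,
X11b@3), Howard frame and frame existence unprinted. Beyond-print BSD theorem: NO. `--supports stmt-BirchSwinnertonDyer-20214`.

References: [Castella2018] Thm. 3.1 (the frame predicate); [SerreLocalFields1979] Ch. IV §4 (units of `R₀`);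
[JetchevSkinnerWan2017] Thm. 3.3.1, §7.4.1 (the value data this route consumes, not used here);
[CastellaGrossiLeeSkinner2022] Thm. 5.1.3.
-/

noncomputable section

open scoped Classical Topology

set_option linter.dupNamespace false
set_option autoImplicit false

namespace Summit.BirchSwinnertonDyer.BirchSwinnertonDyer.Theorems.UniversalToricDescentTwinSplit

open Filter PowerSeries WeierstrassCurve NumberField IsDedekindDomain Field
  Literature.NumberTheory.EllipticCurves
  Literature.NumberTheory.EllipticCurves.ModularForms
  Literature.NumberTheory.EllipticCurves.Rank1Residual
  Literature.NumberTheory.GaloisRepresentations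
  Summit.BirchSwinnertonDyer.Rank1Residual
  Summit.BirchSwinnertonDyer.Rank1Residual.X11b
  Summit.BirchSwinnertonDyer.Rank1Residual.X11b.Halves
  Summit.BirchSwinnertonDyer.BirchSwinnertonDyer.Theorems.SchneiderFree

/-! ## §1 Unit detection in `R₀⟦T⟧` (any prime) -/

section AnyPrime

variable {p : ℕ} [hp : Fact p.Prime]

/-- **Unit detection.** In `R₀⟦T⟧`: if `L ∈ (F)`, `F(0) ≠ 0` and `‖L(0)‖ = ‖F(0)‖` (norms in `ℂ_p`), then
`(F) = (L)` — writing `L = q·F`, `‖q(0)‖ = 1`, so `q(0) ∈ R₀ˣ` (`R₀` is a valuation ring) and `q ∈ R₀⟦T⟧ˣ`.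
[cite: SerreLocalFields1979, Ch. IV §4, Prop. 16 (units of the valuation ring `R₀`)] -/
theorem span_singleton_eq_of_mem_of_norm_constantCoeff_eq {F L : UnrSeries p}
    (hmem : L ∈ Ideal.span ({F} : Set (UnrSeries p)))
    (hF0 : PowerSeries.constantCoeff F ≠ 0)
    (heq : ‖((PowerSeries.constantCoeff L : unrIntegers p) : ℂ_[p])‖ =
      ‖((PowerSeries.constantCoeff F : unrIntegers p) : ℂ_[p])‖) :
    Ideal.span ({F} : Set (UnrSeries p)) = Ideal.span {L} := by
  obtain ⟨q, rfl⟩ := Ideal.mem_span_singleton'.mp hmem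
  have hF0' : ‖((PowerSeries.constantCoeff F : unrIntegers p) : ℂ_[p])‖ ≠ 0 := by
    rw [norm_ne_zero_iff]
    exact_mod_cast hF0
  have hq1 : ‖((PowerSeries.constantCoeff q : unrIntegers p) : ℂ_[p])‖ = 1 := by
    have h := heq
    rw [map_mul, Subring.coe_mul, norm_mul] at h
    -- `‖q(0)‖ · ‖F(0)‖ = ‖F(0)‖`
    have : ‖((PowerSeries.constantCoeff q : unrIntegers p) : ℂ_[p])‖ *
        ‖((PowerSeries.constantCoeff F : unrIntegers p) : ℂ_[p])‖ =
        1 * ‖((PowerSeries.constantCoeff F : unrIntegers p) : ℂ_[p])‖ := by rw [one_mul]; exact h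
    exact mul_right_cancel₀ hF0' this
  have hqu : IsUnit q :=
    PowerSeries.isUnit_iff_constantCoeff.mpr ((unrIntegers.isUnit_iff_norm_eq_one _).mpr hq1)
  exact (Ideal.span_singleton_mul_left_unit hqu F).symm

variable {K : Type} [Field K] [NumberField K] {N : ℕ}
  {ι : PadicAlgCl p ≃+* ℂ} {𝔭 : HeightOneSpectrum (𝓞 K)} {κ : ZpExtension K p}
  {γ : Field.absoluteGaloisGroup K} {f : CuspForm (CongruenceSubgroup.Gamma0 N) 2}

/-- **Howard frame + value frame give the identity at every frame.** `K` imaginary quadratic, `κ`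
anticyclotomic with topological generator `γ`; `I = (F)` a PRINCIPAL ideal of `R₀⟦T⟧` with `F(0) ≠ 0`. If
SOME frame has `L₁ ∈ I` (Howard direction) and SOME frame `L₂` has `‖L₂(0)‖ = ‖F(0)‖` (value data), then
`I = (L′)` for EVERY frame `L′` (rigidity moves `L₁ ∈ I` to the second frame; unit detection; rigidity).
[cite: Castella2018, Thm. 3.1 (arXiv:1704.06608 p. 9) (the frame predicate)] -/
theorem eq_span_forall_frame_of_howardFrame_of_valueFrame (hK : IsImaginaryQuadratic K)
    (hκ : κ.IsAnticyclotomic) (hγ : κ.IsTopGenerator γ) {I : Ideal (UnrSeries p)} {F : UnrSeries p}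
    (hI : I = Ideal.span {F}) (hF0 : PowerSeries.constantCoeff F ≠ 0)
    (h₁ : ∃ (ΩK : ℂ) (Ωp : ℂ_[p]) (L : UnrSeries p), ΩK ≠ 0 ∧ Ωp ≠ 0 ∧
      IsBDPLFunction ι 𝔭 κ γ f ΩK Ωp L ∧ L ∈ I)
    (h₂ : ∃ (ΩK : ℂ) (Ωp : ℂ_[p]) (L : UnrSeries p), ΩK ≠ 0 ∧ Ωp ≠ 0 ∧
      IsBDPLFunction ι 𝔭 κ γ f ΩK Ωp L ∧
      ‖((PowerSeries.constantCoeff L : unrIntegers p) : ℂ_[p])‖ =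
        ‖((PowerSeries.constantCoeff F : unrIntegers p) : ℂ_[p])‖) :
    ∀ (ΩK' : ℂ) (Ωp' : ℂ_[p]) (L' : UnrSeries p), ΩK' ≠ 0 → Ωp' ≠ 0 →
      IsBDPLFunction ι 𝔭 κ γ f ΩK' Ωp' L' → I = Ideal.span {L'} := by
  obtain ⟨ΩK₂, Ωp₂, L₂, hΩK₂, hΩp₂, hL₂, hval⟩ := h₂
  have hmem₂ : L₂ ∈ Ideal.span ({F} : Set (UnrSeries p)) := by
    have h := span_le_forall_frame_of_exists_mem hK hκ hγ h₁ ΩK₂ Ωp₂ L₂ hΩK₂ hΩp₂ hL₂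
    rw [hI, Ideal.span_singleton_le_iff_mem] at h
    exact h
  have heq₂ : I = Ideal.span {L₂} := by
    rw [hI]
    exact span_singleton_eq_of_mem_of_norm_constantCoeff_eq hmem₂ hF0 hval
  exact forall_frame_eq_span_of_exists hK hκ hγ ⟨ΩK₂, Ωp₂, L₂, hΩK₂, hΩp₂, hL₂, heq₂⟩

end AnyPrime

/-! ## §2 `p = 3`, the crux's literal currency, ANY twin -/

section Crux

variable (W' : WeierstrassCurve ℚ) (N' : ℕ) [NeZero N']
  (K : Type) [Field K] [NumberField K] (Dt' : ModularParametrizationData W' N')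
  (κ : ZpExtension K 3) (γ : absoluteGaloisGroup K)
  (𝔭 𝔭' : HeightOneSpectrum (𝓞 K)) (ι' : PadicAlgCl 3 ≃+* ℂ)

/-- **Crux #3 at ANY twin from a Howard frame and value data (the CNF-upgrade route).** For ANY `W′/ℚ`
with datum `Dt′`, `K` imaginary quadratic, `κ` anticyclotomic with topological generator `γ`, any
`𝔭, 𝔭′, ι′`: suppose `Ch_Λ(X_ac(W′_K) strict at 𝔭′)·R₀⟦T⟧ = (F)` is principal with `F(0) ≠ 0` (anticyclotomic
CONTROL at `T = 0` supplies this together with the valuation of `F(0)`), SOME frame `L₁` of `f_{W′}` at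
`(ι′, 𝔭)` lies in it (HOWARD direction), and SOME frame `L₂` has `‖L₂(0)‖ = ‖F(0)‖` (VALUE data: the BDP value
formula at `𝟙` + the `p`-part of BSD for `W′/K`). Then conjuncts (i) ∧ (ii) of `TwinSplitIMCAtThree` hold
verbatim at `(W′, N′, K, Dt′, κ, γ, 𝔭, 𝔭′, ι′)`. Bucket-free; nothing number-theoretic assumed.
[cite: Castella2018, Thm. 3.1 (arXiv:1704.06608 p. 9) (the frame predicate)]
[cite: JetchevSkinnerWan2017, Thm. 3.3.1 and §7.4.1 (arXiv:1512.06894 pp. 11, 30) (the shape of the value data; not used in the proof)] -/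
theorem twinSplit_instance_of_howardFrame_of_valueFrame
    (hK : IsImaginaryQuadratic K) (hκ : κ.IsAnticyclotomic) [hγ : Fact (κ.IsTopGenerator γ)]
    {F : UnrSeries 3}
    (hCh : (AcSelmer.XAc.charIdeal (W'.baseChange K) 3 κ 𝔭' ∅ γ).map (PowerSeries.map (toUnr 3)) =
      Ideal.span {F})
    (hF0 : PowerSeries.constantCoeff F ≠ 0)
    (hHow : ∃ (ΩK : ℂ) (Ωp : ℂ_[3]) (L : UnrSeries 3), ΩK ≠ 0 ∧ Ωp ≠ 0 ∧
      IsBDPLFunction ι' 𝔭 κ γ Dt'.f ΩK Ωp L ∧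
      L ∈ (AcSelmer.XAc.charIdeal (W'.baseChange K) 3 κ 𝔭' ∅ γ).map (PowerSeries.map (toUnr 3)))
    (hVal : ∃ (ΩK : ℂ) (Ωp : ℂ_[3]) (L : UnrSeries 3), ΩK ≠ 0 ∧ Ωp ≠ 0 ∧
      IsBDPLFunction ι' 𝔭 κ γ Dt'.f ΩK Ωp L ∧
      ‖((PowerSeries.constantCoeff L : unrIntegers 3) : ℂ_[3])‖ =
        ‖((PowerSeries.constantCoeff F : unrIntegers 3) : ℂ_[3])‖) :
    (∃ (ΩK : ℂ) (Ωp : ℂ_[3]) (L' : UnrSeries 3), ΩK ≠ 0 ∧ Ωp ≠ 0 ∧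
        IsBDPLFunction ι' 𝔭 κ γ Dt'.f ΩK Ωp L') ∧
      (∀ (ΩK : ℂ) (Ωp : ℂ_[3]) (L' : UnrSeries 3), ΩK ≠ 0 → Ωp ≠ 0 →
        IsBDPLFunction ι' 𝔭 κ γ Dt'.f ΩK Ωp L' →
        (AcSelmer.XAc.charIdeal (W'.baseChange K) 3 κ 𝔭' ∅ γ).map (PowerSeries.map (toUnr 3)) =
          Ideal.span {L'}) := by
  refine ⟨?_, eq_span_forall_frame_of_howardFrame_of_valueFrame hK hκ hγ.out hCh hF0 hHow hVal⟩
  obtain ⟨ΩK, Ωp, L, hΩK, hΩp, hL, -⟩ := hHow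
  exact ⟨ΩK, Ωp, L, hΩK, hΩp, hL⟩

end Crux

end Summit.BirchSwinnertonDyer.BirchSwinnertonDyer.Theorems.UniversalToricDescentTwinSplit

end
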